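import Summits.QuantumFields.YangMills.Theorems.UnitScaleTiltProp7AvgHessGaugePointwiseIdentity
import Mathlib.Analysis.Complex.Liouville
import HarnessLib

/-!
# (q-gauge) SUPPLIER, «FR₂-lite» ROUTE R2 — F-C: **THE FRAME-CORRECTED PARAMETER `κ(s)` IS HOLOMORPHIC ON THE CHART DISC, AND THE CAUCHY DOOR FOR `κY`** —
# `‖κY(x)‖ ≤ M(x)∕R` and `Σ_x ‖κY(x)‖ ≤ R⁻¹·Σ_x M(x)` from ANY s-free majorant `‖κ_x(s)‖ ≤ M(x)` on the circle `‖s‖ = R`, `R·sup‖Y‖ ≤ e·η`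

Cell `ym3-torus` (HUMAN RULING D-0037, YM ladder rung R3 — SU(2) YM₃ on T³: NOT d = 4, NOT infinite volume, NOT a mass gap, NOT Clay).  Width seat `ym3-torus-px12` (gen 18), pen «F-C» of
px16 g15's route R2 for «FR₂-lite» (GO 2026-08-30T17:08Z: px16 keeps F-B = the s-free majorant, px12 takes F-C = holomorphy + Cauchy and F-D = the knit into ✓p777532).  THEOREMS ONLY
(0 `def`, 0 `sorry`, default heartbeats); `--supports stmt-QuantumFields-19200 --as helper`; count-neutral; NO claim on crux ∕ stub ∕ registry.

THE POINT.  «FR₂-lite» is the per-member site-mass row `Σ_z ‖κY Y x A z‖ ≤ C L·ℓ⁻²·s·‖A‖` of the chart×gauge mixed derivative `κY` (F3 ✓`Prop7FrameResponseAtChartPoint.hasDerivAt_kappaAt_smul`,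
x-form F4 ✓`Prop7AvgHessGaugePointwiseIdentity.hasDerivAt_kappaAt_smul_site`): `κY(x) = κ′_x(0)` for the frame-corrected coarse parameter along the chart ray
`κ_x(s) = w_x(sY)⁻¹·(N(x̂) − Dw_x(sY)[V(sY)]·w_x(sY)⁻¹)·w_x(sY)`, `w_x(A) = frameAccU (K−n) U₀♭ (e^{A}U₀♭) x`, `V(A)(b) = Dlog(e^{A(b)})[N(b₋)e^{A(b)} − e^{A(b)}·Ad_{U₀(b)}N(b₊)]`.
Route R2 (px16 g15) bounds `κY` by CAUCHY: an s-FREE site majorant `‖κ_x(s)‖ ≤ M(x)` on the chart disc (F-B, the corrected-parameter tower ✓`Prop7CorrectedParamLevelBound` ∕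
`…CorrectedParamTowerMass`, `Σ_x M(x) ≤ C_B·ℓ⁻³·‖A‖`) and the radius `R = e·η∕sup‖Y‖` give `Σ_x‖κY(x)‖ ≤ R⁻¹·Σ_x M(x) = (C_B∕e)·ℓ⁻²·sup‖Y‖·‖A‖` — «FR₂-lite» with an L-only constant.
THIS FILE is the complex-analytic half: (§2) every piece of `κ_x(s)` is ℂ-differentiable at every `s₀` of the closed chart disc `‖s₀‖·sup‖Y‖ ≤ e·η` — the frames by W5∕★px18
✓`Prop7SymFrameBound.analyticAt_frameTwS_of_regPr` (analytic at EVERY `A₀` of the polydisc `‖A₀(b)‖ ≤ e·η`, windows `10¹²L³ε₀ ≤ 1`, `10⁹L²e ≤ 1`), their `A`-derivative by `AnalyticAt.fderiv`,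
the inverse frame by F3 ✓`hasDerivAt_units_inv_complex`, the velocity family bondwise by ✓`MatrixLog.analyticAt_mlog` at `e^{s₀Y(b)}` (`‖s₀Y(b)‖ < log 2`, F3 ✓`lt_log_two_of_le_e_eta`,
F2 ✓`norm_exp_sub_one_lt_one_of_lt_log_two`) and `hasDerivAt_exp_smul_const`; hence `κ_x` is `DiffContOnCl` on the disc `‖s‖ < R` whenever `R·sup‖Y‖ ≤ e·η`; (§1, §3) Mathlib's Cauchy
estimate ✓`Complex.norm_deriv_le_of_forall_mem_sphere_norm_le` then turns any circle majorant into the row, pointwise and summed, and (§3) in «FR₂-lite»'s own units.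

WHAT IS PROVED (namespace `…Theorems.Prop7KappaAtDiscCauchy`; member `F`, `h : n ≤ K`; `x : Site (F.P K) (K − n)` a top-level site; `N`, `ns` ANY gauge parameter and averaging sequence, as in F3∕F4).
* §1 `norm_le_div_of_hasDerivAt_of_sphere`, `diffContOnCl_ball_of_differentiableAt`, `sum_norm_le_inv_mul_sum_of_sphere` — the Cauchy doors, generic (`E` a normed space over ℂ, finite index).
* §2 `differentiableAt_frameAccU_smul`, `differentiableAt_fderiv_frameAccU_smul`, `differentiableAt_gaugeVelocity_smul`, `differentiableAt_frameResponse_smul`, `differentiableAt_frameAccU_inv_smul`,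
  ★★ `differentiableAt_kappaAt_smul` (at every `s₀` with `‖s₀‖·sY ≤ e·η`, `‖Y(b)‖ ≤ sY`), ★★ `diffContOnCl_kappaAt_smul` (on `‖s‖ < R`, `R·sY ≤ e·η`).
* §3 ★★★ `norm_kappaY_le_of_sphere` — `‖κY(x)‖ ≤ M∕R` from `∀ s, ‖s‖ = R → ‖κ_x(s)‖ ≤ M` (`0 < R`, `R·sY ≤ e·η`), the derivative being F4's `κY(x)` VERBATIM; ★★★ `sum_norm_kappaY_le_of_sphere` —
  `Σ_x ‖κY(x)‖ ≤ R⁻¹·Σ_x M(x)`; ★★★ `sum_norm_kappaY_le_of_majorant` — at `R := e·η∕sY`: `Σ_x M(x) ≤ C_B·(ℓ⁻¹)³·a` ⟹ `Σ_x ‖κY(x)‖ ≤ (C_B∕e)·(ℓ⁻¹)²·sY·a` («FR₂-lite»'s shape; F-D sockets F-B here).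
HONEST SCOPE.  Holomorphy bookkeeping and the Cauchy inequality; the majorant `M` (F-B) is DISPLAYED, not proved; «FR₂-lite», `hqG`, norm_H₁, norm_G, the 8 EX rows, EX, the crux and rung R3 are NOT
proved; the Yang–Mills mass gap is NOT proved.

References: T. Bałaban, CMP **98** (1985) 17–51 [Balaban1985Averaging] ((97) p.32, Prop. 4 p.38, (159)–(163) p.42); CMP **99** (1985) 389–434 [Balaban1985BackgroundPropagators] ((3.19) p.393,
(3.114)–(3.115) p.418); the Cauchy estimate is Mathlib's `Complex.norm_deriv_le_of_forall_mem_sphere_norm_le` [folklore].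
-/

set_option autoImplicit false

noncomputable section

open scoped Topology Matrix.Norms.L2Operator
open Filter NormedSpace

namespace Summit.QuantumFields.YangMills.Theorems.Prop7KappaAtDiscCauchy

open Literature.MathematicalPhysics.QuantumFieldTheory.Balaban1983to89
open Literature.MathematicalPhysics.QuantumFieldTheory.Balaban1983to89.T3ContinuumYM3Torus
open MatrixLog (mlog)
open B10Eq27TorusAxialLog (holT transl)
open B7Prop1Explicit (expUnit disp)
open B7TransferAnalyticMean (meanCLM)
open T4Continuum BlockAveraging
open T3PrintedRegularMinimiser (RegPr)
open T3PrintedRegularOrbits (sites_eq)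
open T3LevelShift (siteShift)
open T3SectALandauChart (bgUnits eta eta_pos)
open B15DeterminingSets (embIter)
open Summit.QuantumFields.YangMills.Theorems.Prop8Chart (emlIterU)
open Summit.QuantumFields.YangMills.Theorems.Prop7SymAvgTwSym (frameAccU frameTwS frameTwS_def)
open Summit.QuantumFields.YangMills.Theorems.Prop7SymFrameBound (analyticAt_frameTwS_of_regPr)
open Summit.QuantumFields.YangMills.Theorems.Prop7ChartGaugeCurveAt (norm_exp_sub_one_lt_one_of_lt_log_two)
open Summit.QuantumFields.YangMills.Theorems.Prop7FrameResponseAtChartPoint (hasDerivAt_units_inv_complex lt_log_two_of_le_e_eta)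
open Summit.QuantumFields.YangMills.Theorems.Prop7AvgHessGaugePointwiseIdentity (hasDerivAt_kappaAt_smul_site)

/-! ## §1 The Cauchy doors (generic) -/

section Cauchy

variable {E : Type*} [NormedAddCommGroup E] [NormedSpace ℂ E]

/-- **CAUCHY'S ESTIMatrix (Fin 2) (Fin 2) ℂE FOR A NAMED DERIVATIVE AT THE CENTRE**: `f` holomorphic on `‖s‖ < R` and continuous up to the circle, `‖f s‖ ≤ M` on `‖s‖ = R`, `f′(0) = f'` ⟹ `‖f'‖ ≤ M∕R`
(Mathlib ✓`Complex.norm_deriv_le_of_forall_mem_sphere_norm_le` with the derivative read by `HasDerivAt.deriv`). [folklore] -/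
theorem norm_le_div_of_hasDerivAt_of_sphere {f : ℂ → E} {f' : E} {R M : ℝ} (hR : 0 < R) (hdc : DiffContOnCl ℂ f (Metric.ball 0 R))
    (hf : HasDerivAt f f' 0) (hM : ∀ s : ℂ, ‖s‖ = R → ‖f s‖ ≤ M) : ‖f'‖ ≤ M / R := by
  rw [← hf.deriv]
  exact Complex.norm_deriv_le_of_forall_mem_sphere_norm_le hR hdc fun z hz => hM z (mem_sphere_zero_iff_norm.1 hz)

/-- **DIFFERENTIABLE ON THE CLOSED DISC ⟹ `DiffContOnCl` ON THE OPEN DISC** (`closure (ball 0 R) ⊆ closedBall 0 R`). [folklore] -/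
theorem diffContOnCl_ball_of_differentiableAt {f : ℂ → E} {R : ℝ} (hd : ∀ s : ℂ, ‖s‖ ≤ R → DifferentiableAt ℂ f s) :
    DiffContOnCl ℂ f (Metric.ball 0 R) := by
  refine DifferentiableOn.diffContOnCl fun s hs => ?_
  exact (hd s (mem_closedBall_zero_iff.1 (Metric.closure_ball_subset_closedBall hs))).differentiableWithinAt

/-- **THE SUMMED CAUCHY DOOR**: finitely many holomorphic `f_i` on the disc with circle majorants `M i` ⟹ `Σ_i ‖f_i′(0)‖ ≤ R⁻¹·Σ_i M i`. [folklore] -/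
theorem sum_norm_le_inv_mul_sum_of_sphere {ι : Type*} [Fintype ι] {f : ι → ℂ → E} {f' : ι → E} {R : ℝ} {M : ι → ℝ} (hR : 0 < R)
    (hdc : ∀ i, DiffContOnCl ℂ (f i) (Metric.ball 0 R)) (hf : ∀ i, HasDerivAt (f i) (f' i) 0) (hM : ∀ (i) (s : ℂ), ‖s‖ = R → ‖f i s‖ ≤ M i) :
    ∑ i, ‖f' i‖ ≤ R⁻¹ * ∑ i, M i := by
  rw [Finset.mul_sum]
  refine Finset.sum_le_sum fun i _ => ?_
  rw [inv_mul_eq_div]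
  exact norm_le_div_of_hasDerivAt_of_sphere hR (hdc i) (hf i) (hM i)

end Cauchy

/-! ## §2 Every piece of `κ_x(s)` is holomorphic on the chart disc -/

section Member

variable (F : T3Family) {n K : ℕ} (h : n ≤ K)

/-- **THE CHART RAY STAYS IN THE POLYDISC**: `‖Y(b)‖ ≤ sY`, `‖s₀‖·sY ≤ e·η` ⟹ `‖(s₀•Y)(b)‖ ≤ e·η` bondwise. [folklore] -/
theorem norm_smul_apply_le_of_le {Y : PBond (F.P K) 0 → Matrix (Fin 2) (Fin 2) ℂ} {sY e' : ℝ} (hY : ∀ b, ‖Y b‖ ≤ sY) {s₀ : ℂ} (hs₀ : ‖s₀‖ * sY ≤ e')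
    (b : PBond (F.P K) 0) : ‖(s₀ • Y) b‖ ≤ e' := by
  rw [Pi.smul_apply, norm_smul]
  exact (mul_le_mul_of_nonneg_left (hY b) (norm_nonneg _)).trans hs₀

include h in
/-- ★ **THE ACCUMULATED FRAME ALONG THE CHART RAY IS HOLOMORPHIC AT EVERY POINT OF THE DISC**: for `RegPr F n K ε₀ U₀`, `10¹²L³ε₀ ≤ 1`, `10⁹L²e ≤ 1`, `‖Y(b)‖ ≤ sY` and `‖s₀‖·sY ≤ e·η`,
`s ↦ w_x(sY)` is ℂ-differentiable at `s₀` — ✓`analyticAt_frameTwS_of_regPr` at `A₀ = s₀•Y` composed with the linear ray. [cite: Balaban1985Averaging, (97) p.32, Prop. 4 p.38] -/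
theorem differentiableAt_frameAccU_smul {ε₀ e : ℝ} (hε₀ : 0 < ε₀) (he : 0 ≤ e) (hWε : 10 ^ 12 * (F.L : ℝ) ^ 3 * ε₀ ≤ 1) (hWe : 10 ^ 9 * (F.L : ℝ) ^ 2 * e ≤ 1)
    (U₀ : GaugeField (F.P K) 0 (Matrix.specialUnitaryGroup (Fin 2) ℂ)) (hreg : RegPr F n K ε₀ U₀) {Y : PBond (F.P K) 0 → Matrix (Fin 2) (Fin 2) ℂ} {sY : ℝ} (hY : ∀ b, ‖Y b‖ ≤ sY)
    {s₀ : ℂ} (hs₀ : ‖s₀‖ * sY ≤ e * eta F n K) (x : Site (F.P K) (K - n)) :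
    DifferentiableAt ℂ (fun s : ℂ => ((frameAccU (K - n) (bgUnits F K U₀) (fun b => expUnit ((s • Y) b) * bgUnits F K U₀ b) x : (Matrix (Fin 2) (Fin 2) ℂ)ˣ) : Matrix (Fin 2) (Fin 2) ℂ)) s₀ := by
  have hA₀ : ∀ b, ‖(s₀ • Y) b‖ ≤ e * eta F n K := norm_smul_apply_le_of_le F hY hs₀
  have han := (analyticAt_frameTwS_of_regPr F h hε₀ he hWε hWe U₀ hreg ((siteShift (sites_eq F n K h)).symm x) hA₀).1
  have hl : DifferentiableAt ℂ (fun s : ℂ => s • Y) s₀ := differentiableAt_id.smul_const Y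
  have hc := han.differentiableAt.comp s₀ hl
  simpa only [Function.comp_def, frameTwS_def, Equiv.apply_symm_apply] using hc

include h in
/-- ★ **SO IS ITS `A`-DERIVATIVE ALONG THE RAY**: `s ↦ Dw_x(sY)` (a continuous-linear-map-valued curve) is ℂ-differentiable at every `s₀` of the disc — `AnalyticAt.fderiv` of the same analytic germ.
[cite: Balaban1985Averaging, (97) p.32, Prop. 4 p.38] -/
theorem differentiableAt_fderiv_frameAccU_smul {ε₀ e : ℝ} (hε₀ : 0 < ε₀) (he : 0 ≤ e) (hWε : 10 ^ 12 * (F.L : ℝ) ^ 3 * ε₀ ≤ 1) (hWe : 10 ^ 9 * (F.L : ℝ) ^ 2 * e ≤ 1)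
    (U₀ : GaugeField (F.P K) 0 (Matrix.specialUnitaryGroup (Fin 2) ℂ)) (hreg : RegPr F n K ε₀ U₀) {Y : PBond (F.P K) 0 → Matrix (Fin 2) (Fin 2) ℂ} {sY : ℝ} (hY : ∀ b, ‖Y b‖ ≤ sY)
    {s₀ : ℂ} (hs₀ : ‖s₀‖ * sY ≤ e * eta F n K) (x : Site (F.P K) (K - n)) :
    DifferentiableAt ℂ (fun s : ℂ => fderiv ℂ (fun A : PBond (F.P K) 0 → Matrix (Fin 2) (Fin 2) ℂ => ((frameAccU (K - n) (bgUnits F K U₀) (fun b => expUnit (A b) * bgUnits F K U₀ b) x : (Matrix (Fin 2) (Fin 2) ℂ)ˣ) : Matrix (Fin 2) (Fin 2) ℂ)) (s • Y)) s₀ := by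
  have hA₀ : ∀ b, ‖(s₀ • Y) b‖ ≤ e * eta F n K := norm_smul_apply_le_of_le F hY hs₀
  have han := (analyticAt_frameTwS_of_regPr F h hε₀ he hWε hWe U₀ hreg ((siteShift (sites_eq F n K h)).symm x) hA₀).1
  have hl : DifferentiableAt ℂ (fun s : ℂ => s • Y) s₀ := differentiableAt_id.smul_const Y
  have hc := han.fderiv.differentiableAt.comp s₀ hl
  simpa only [Function.comp_def, frameTwS_def, Equiv.apply_symm_apply] using hc

/-- ★ **THE GAUGE VELOCITY FAMILY ALONG THE RAY IS HOLOMORPHIC**: bondwise `s ↦ V(sY)(b) = Dlog(e^{sY(b)})[N(b₋)e^{sY(b)} − e^{sY(b)}·Ad_{U₀(b)}N(b₊)]` is ℂ-differentiable at every `s₀` with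
`‖s₀‖·sY ≤ e·η` (`10⁹L²e ≤ 1` puts `e^{s₀Y(b)}` in `log`'s ball: ✓`lt_log_two_of_le_e_eta`, ✓`norm_exp_sub_one_lt_one_of_lt_log_two`, ✓`MatrixLog.analyticAt_mlog`, `AnalyticAt.fderiv`,
`hasDerivAt_exp_smul_const`, `DifferentiableAt.clm_apply`). [cite: Balaban1985Averaging, (21) p.21; Balaban1985BackgroundPropagators, (3.114)–(3.115) p.418] -/
theorem differentiableAt_gaugeVelocity_smul {e : ℝ} (hWe : 10 ^ 9 * (F.L : ℝ) ^ 2 * e ≤ 1) (U₀ : GaugeField (F.P K) 0 (Matrix.specialUnitaryGroup (Fin 2) ℂ))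
    (N : Site (F.P K) 0 → Matrix (Fin 2) (Fin 2) ℂ) {Y : PBond (F.P K) 0 → Matrix (Fin 2) (Fin 2) ℂ} {sY : ℝ} (hY : ∀ b, ‖Y b‖ ≤ sY) {s₀ : ℂ} (hs₀ : ‖s₀‖ * sY ≤ e * eta F n K) :
    DifferentiableAt ℂ (fun s : ℂ => (fun b : PBond (F.P K) 0 => fderiv ℂ (mlog : Matrix (Fin 2) (Fin 2) ℂ → Matrix (Fin 2) (Fin 2) ℂ) (exp ((s • Y) b)) (N b.src * exp ((s • Y) b) - exp ((s • Y) b) * (((bgUnits F K U₀ b : (Matrix (Fin 2) (Fin 2) ℂ)ˣ) : Matrix (Fin 2) (Fin 2) ℂ) * N b.tgt * (((bgUnits F K U₀ b)⁻¹ : (Matrix (Fin 2) (Fin 2) ℂ)ˣ) : Matrix (Fin 2) (Fin 2) ℂ))))) s₀ := by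
  have hA₀ : ∀ b, ‖(s₀ • Y) b‖ ≤ e * eta F n K := norm_smul_apply_le_of_le F hY hs₀
  have hlog : ∀ b, ‖(s₀ • Y) b‖ < Real.log 2 := lt_log_two_of_le_e_eta hWe hA₀
  refine differentiableAt_pi.2 fun b => ?_
  have hexp : DifferentiableAt ℂ (fun s : ℂ => exp ((s • Y) b)) s₀ := (hasDerivAt_exp_smul_const (𝕂 := ℂ) (Y b) s₀).differentiableAt
  have hm : AnalyticAt ℂ (mlog : Matrix (Fin 2) (Fin 2) ℂ → Matrix (Fin 2) (Fin 2) ℂ) (exp ((s₀ • Y) b)) := MatrixLog.analyticAt_mlog (norm_exp_sub_one_lt_one_of_lt_log_two (hlog b))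
  have h1 : DifferentiableAt ℂ (fun s : ℂ => fderiv ℂ (mlog : Matrix (Fin 2) (Fin 2) ℂ → Matrix (Fin 2) (Fin 2) ℂ) (exp ((s • Y) b))) s₀ := by
    have hc := hm.fderiv.differentiableAt.comp s₀ hexp
    simpa only [Function.comp_def] using hc
  have h2 : DifferentiableAt ℂ (fun s : ℂ => N b.src * exp ((s • Y) b) - exp ((s • Y) b) * (((bgUnits F K U₀ b : (Matrix (Fin 2) (Fin 2) ℂ)ˣ) : Matrix (Fin 2) (Fin 2) ℂ) * N b.tgt * (((bgUnits F K U₀ b)⁻¹ : (Matrix (Fin 2) (Fin 2) ℂ)ˣ) : Matrix (Fin 2) (Fin 2) ℂ))) s₀ := (hexp.const_mul _).sub (hexp.mul_const _)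
  exact h1.clm_apply h2

include h in
/-- ★ **THE FRAME RESPONSE `s ↦ vd_x(s) = Dw_x(sY)[V(sY)]` IS HOLOMORPHIC ON THE DISC** (`DifferentiableAt.clm_apply` of the two preceding curves). [cite: Balaban1985Averaging, (97) p.32, Prop. 4 p.38] -/
theorem differentiableAt_frameResponse_smul {ε₀ e : ℝ} (hε₀ : 0 < ε₀) (he : 0 ≤ e) (hWε : 10 ^ 12 * (F.L : ℝ) ^ 3 * ε₀ ≤ 1) (hWe : 10 ^ 9 * (F.L : ℝ) ^ 2 * e ≤ 1)
    (U₀ : GaugeField (F.P K) 0 (Matrix.specialUnitaryGroup (Fin 2) ℂ)) (hreg : RegPr F n K ε₀ U₀) {Y : PBond (F.P K) 0 → Matrix (Fin 2) (Fin 2) ℂ} {sY : ℝ} (hY : ∀ b, ‖Y b‖ ≤ sY)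
    (N : Site (F.P K) 0 → Matrix (Fin 2) (Fin 2) ℂ) {s₀ : ℂ} (hs₀ : ‖s₀‖ * sY ≤ e * eta F n K) (x : Site (F.P K) (K - n)) :
    DifferentiableAt ℂ (fun s : ℂ => fderiv ℂ (fun A : PBond (F.P K) 0 → Matrix (Fin 2) (Fin 2) ℂ => ((frameAccU (K - n) (bgUnits F K U₀) (fun b => expUnit (A b) * bgUnits F K U₀ b) x : (Matrix (Fin 2) (Fin 2) ℂ)ˣ) : Matrix (Fin 2) (Fin 2) ℂ)) (s • Y) (fun b : PBond (F.P K) 0 => fderiv ℂ (mlog : Matrix (Fin 2) (Fin 2) ℂ → Matrix (Fin 2) (Fin 2) ℂ) (exp ((s • Y) b)) (N b.src * exp ((s • Y) b) - exp ((s • Y) b) * (((bgUnits F K U₀ b : (Matrix (Fin 2) (Fin 2) ℂ)ˣ) : Matrix (Fin 2) (Fin 2) ℂ) * N b.tgt * (((bgUnits F K U₀ b)⁻¹ : (Matrix (Fin 2) (Fin 2) ℂ)ˣ) : Matrix (Fin 2) (Fin 2) ℂ))))) s₀ :=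
  (differentiableAt_fderiv_frameAccU_smul F h hε₀ he hWε hWe U₀ hreg hY hs₀ x).clm_apply (differentiableAt_gaugeVelocity_smul F hWe U₀ N hY hs₀)

include h in
/-- ★ **THE INVERSE FRAME ALONG THE RAY IS HOLOMORPHIC** (F3 ✓`hasDerivAt_units_inv_complex` on the unit-valued curve of `differentiableAt_frameAccU_smul`). [cite: Balaban1985Averaging, (97) p.32] -/
theorem differentiableAt_frameAccU_inv_smul {ε₀ e : ℝ} (hε₀ : 0 < ε₀) (he : 0 ≤ e) (hWε : 10 ^ 12 * (F.L : ℝ) ^ 3 * ε₀ ≤ 1) (hWe : 10 ^ 9 * (F.L : ℝ) ^ 2 * e ≤ 1)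
    (U₀ : GaugeField (F.P K) 0 (Matrix.specialUnitaryGroup (Fin 2) ℂ)) (hreg : RegPr F n K ε₀ U₀) {Y : PBond (F.P K) 0 → Matrix (Fin 2) (Fin 2) ℂ} {sY : ℝ} (hY : ∀ b, ‖Y b‖ ≤ sY)
    {s₀ : ℂ} (hs₀ : ‖s₀‖ * sY ≤ e * eta F n K) (x : Site (F.P K) (K - n)) :
    DifferentiableAt ℂ (fun s : ℂ => (((frameAccU (K - n) (bgUnits F K U₀) (fun b => expUnit ((s • Y) b) * bgUnits F K U₀ b) x)⁻¹ : (Matrix (Fin 2) (Fin 2) ℂ)ˣ) : Matrix (Fin 2) (Fin 2) ℂ)) s₀ :=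
  (hasDerivAt_units_inv_complex (γ := fun s : ℂ => frameAccU (K - n) (bgUnits F K U₀) (fun b => expUnit ((s • Y) b) * bgUnits F K U₀ b) x)
    (differentiableAt_frameAccU_smul F h hε₀ he hWε hWe U₀ hreg hY hs₀ x).hasDerivAt).differentiableAt

include h in
/-- ★★ **THE FRAME-CORRECTED COARSE PARAMETER `κ_x(s) = w⁻¹·(N(x̂) − vd·w⁻¹)·w` IS HOLOMORPHIC AT EVERY POINT OF THE CHART DISC** `‖s₀‖·sY ≤ e·η` — the function of F4
✓`hasDerivAt_kappaAt_smul_site` VERBATIM. [cite: Balaban1985BackgroundPropagators, (3.19) p.393, (3.114)–(3.115) p.418; Balaban1985Averaging, (97) p.32, Prop. 4 p.38] -/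
theorem differentiableAt_kappaAt_smul {ε₀ e : ℝ} (hε₀ : 0 < ε₀) (he : 0 ≤ e) (hWε : 10 ^ 12 * (F.L : ℝ) ^ 3 * ε₀ ≤ 1) (hWe : 10 ^ 9 * (F.L : ℝ) ^ 2 * e ≤ 1)
    (U₀ : GaugeField (F.P K) 0 (Matrix.specialUnitaryGroup (Fin 2) ℂ)) (hreg : RegPr F n K ε₀ U₀) {Y : PBond (F.P K) 0 → Matrix (Fin 2) (Fin 2) ℂ} {sY : ℝ} (hY : ∀ b, ‖Y b‖ ≤ sY)
    (N : Site (F.P K) 0 → Matrix (Fin 2) (Fin 2) ℂ) {s₀ : ℂ} (hs₀ : ‖s₀‖ * sY ≤ e * eta F n K) (x : Site (F.P K) (K - n)) :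
    DifferentiableAt ℂ (fun s : ℂ => (((frameAccU (K - n) (bgUnits F K U₀) (fun b => expUnit ((s • Y) b) * bgUnits F K U₀ b) x)⁻¹ : (Matrix (Fin 2) (Fin 2) ℂ)ˣ) : Matrix (Fin 2) (Fin 2) ℂ) * (N (embIter (K - n) x) - fderiv ℂ (fun A : PBond (F.P K) 0 → Matrix (Fin 2) (Fin 2) ℂ => ((frameAccU (K - n) (bgUnits F K U₀) (fun b => expUnit (A b) * bgUnits F K U₀ b) x : (Matrix (Fin 2) (Fin 2) ℂ)ˣ) : Matrix (Fin 2) (Fin 2) ℂ)) (s • Y) (fun b : PBond (F.P K) 0 => fderiv ℂ (mlog : Matrix (Fin 2) (Fin 2) ℂ → Matrix (Fin 2) (Fin 2) ℂ) (exp ((s • Y) b)) (N b.src * exp ((s • Y) b) - exp ((s • Y) b) * (((bgUnits F K U₀ b : (Matrix (Fin 2) (Fin 2) ℂ)ˣ) : Matrix (Fin 2) (Fin 2) ℂ) * N b.tgt * (((bgUnits F K U₀ b)⁻¹ : (Matrix (Fin 2) (Fin 2) ℂ)ˣ) : Matrix (Fin 2) (Fin 2) ℂ)))) * (((frameAccU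 (K - n) (bgUnits F K U₀) (fun b => expUnit ((s • Y) b) * bgUnits F K U₀ b) x)⁻¹ : (Matrix (Fin 2) (Fin 2) ℂ)ˣ) : Matrix (Fin 2) (Fin 2) ℂ)) * ((frameAccU (K - n) (bgUnits F K U₀) (fun b => expUnit ((s • Y) b) * bgUnits F K U₀ b) x : (Matrix (Fin 2) (Fin 2) ℂ)ˣ) : Matrix (Fin 2) (Fin 2) ℂ)) s₀ := by
  have hW := differentiableAt_frameAccU_smul F h hε₀ he hWε hWe U₀ hreg hY hs₀ x
  have hWi := differentiableAt_frameAccU_inv_smul F h hε₀ he hWε hWe U₀ hreg hY hs₀ x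
  have hvd := differentiableAt_frameResponse_smul F h hε₀ he hWε hWe U₀ hreg hY N hs₀ x
  exact (hWi.mul ((differentiableAt_const _).sub (hvd.mul hWi))).mul hW

include h in
/-- ★★ **`κ_x` IS `DiffContOnCl` ON THE DISC `‖s‖ < R` WHENEVER `R·sY ≤ e·η`** (`0 ≤ sY`). [cite: Balaban1985Averaging, (97) p.32, Prop. 4 p.38] -/
theorem diffContOnCl_kappaAt_smul {ε₀ e : ℝ} (hε₀ : 0 < ε₀) (he : 0 ≤ e) (hWε : 10 ^ 12 * (F.L : ℝ) ^ 3 * ε₀ ≤ 1) (hWe : 10 ^ 9 * (F.L : ℝ) ^ 2 * e ≤ 1)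
    (U₀ : GaugeField (F.P K) 0 (Matrix.specialUnitaryGroup (Fin 2) ℂ)) (hreg : RegPr F n K ε₀ U₀) {Y : PBond (F.P K) 0 → Matrix (Fin 2) (Fin 2) ℂ} {sY : ℝ} (hsY : 0 ≤ sY) (hY : ∀ b, ‖Y b‖ ≤ sY)
    (N : Site (F.P K) 0 → Matrix (Fin 2) (Fin 2) ℂ) {R : ℝ} (hR : R * sY ≤ e * eta F n K) (x : Site (F.P K) (K - n)) :
    DiffContOnCl ℂ (fun s : ℂ => (((frameAccU (K - n) (bgUnits F K U₀) (fun b => expUnit ((s • Y) b) * bgUnits F K U₀ b) x)⁻¹ : (Matrix (Fin 2) (Fin 2) ℂ)ˣ) : Matrix (Fin 2) (Fin 2) ℂ) * (N (embIter (K - n) x) - fderiv ℂ (fun A : PBond (F.P K) 0 → Matrix (Fin 2) (Fin 2) ℂ => ((frameAccU (K - n) (bgUnits F K U₀) (fun b => expUnit (A b) * bgUnits F K U₀ b) x : (Matrix (Fin 2) (Fin 2) ℂ)ˣ) : Matrix (Fin 2) (Fin 2) ℂ)) (s • Y) (fun b : PBond (F.P K) 0 => fderiv ℂ (mlog : Matrix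 (Fin 2) (Fin 2) ℂ → Matrix (Fin 2) (Fin 2) ℂ) (exp ((s • Y) b)) (N b.src * exp ((s • Y) b) - exp ((s • Y) b) * (((bgUnits F K U₀ b : (Matrix (Fin 2) (Fin 2) ℂ)ˣ) : Matrix (Fin 2) (Fin 2) ℂ) * N b.tgt * (((bgUnits F K U₀ b)⁻¹ : (Matrix (Fin 2) (Fin 2) ℂ)ˣ) : Matrix (Fin 2) (Fin 2) ℂ)))) * (((frameAccU (K - n) (bgUnits F K U₀) (fun b => expUnit ((s • Y) b) * bgUnits F K U₀ b) x)⁻¹ : (Matrix (Fin 2) (Fin 2) ℂ)ˣ) : Matrix (Fin 2) (Fin 2) ℂ)) * ((frameAccU (K - n) (bgUnits F K U₀) (fun b => expUnit ((s • Y) b) * bgUnits F K U₀ b) x : (Matrix (Fin 2) (Fin 2) ℂ)ˣ) : Matrix (Fin 2) (Fin 2) ℂ)) (Metric.ball 0 R) := by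
  refine diffContOnCl_ball_of_differentiableAt fun s hs => ?_
  have hs' : ‖s‖ * sY ≤ e * eta F n K := (mul_le_mul_of_nonneg_right hs hsY).trans hR
  exact differentiableAt_kappaAt_smul F h hε₀ he hWε hWe U₀ hreg hY N hs' x

/-! ## §3 The Cauchy door for `κY` -/

include h in
/-- ★★★ **THE CAUCHY DOOR FOR THE CHART×GAUGE MIXED DERIVATIVE, POINTWISE**: at a printed-regular background (`RegPr F n K ε₀ U₀`, `10¹²L³ε₀ ≤ 1`, `10⁹L²e ≤ 1`), for a chart direction `Y` with
`‖Y(b)‖ ≤ sY`, ANY gauge parameter `N` with averaging sequence `ns`, a radius `0 < R` with `R·sY ≤ e·η`, and ANY circle majorant `‖κ_x(s)‖ ≤ M` on `‖s‖ = R`:  **`‖κY(x)‖ ≤ M∕R`**, `κY(x)` being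
F4 ✓`hasDerivAt_kappaAt_smul_site`'s derivative VERBATIM (so F3∕F4∕✓p777532 consume it by `exact`). [cite: Balaban1985BackgroundPropagators, (3.19) p.393, (3.114)–(3.115) p.418;
Balaban1985Averaging, (97) p.32, Prop. 4 p.38] -/
theorem norm_kappaY_le_of_sphere {ε₀ e : ℝ} (hε₀ : 0 < ε₀) (he : 0 ≤ e) (hWε : 10 ^ 12 * (F.L : ℝ) ^ 3 * ε₀ ≤ 1) (hWe : 10 ^ 9 * (F.L : ℝ) ^ 2 * e ≤ 1)
    (U₀ : GaugeField (F.P K) 0 (Matrix.specialUnitaryGroup (Fin 2) ℂ)) (hreg : RegPr F n K ε₀ U₀) (Y : PBond (F.P K) 0 → Matrix (Fin 2) (Fin 2) ℂ) {sY : ℝ} (hsY : 0 ≤ sY) (hY : ∀ b, ‖Y b‖ ≤ sY)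
    (N : Site (F.P K) 0 → Matrix (Fin 2) (Fin 2) ℂ) (ns : (j : ℕ) → Site (F.P K) j → Matrix (Fin 2) (Fin 2) ℂ) (h0 : ns 0 = N)
    (hsucc : ∀ (j : ℕ) (z : Site (F.P K) (j + 1)), ns (j + 1) z = ns j (emb z) - meanCLM (Idx (F.P K)) (Matrix (Fin 2) (Fin 2) ℂ) fun i : Idx (F.P K) =>
        ns j (emb z) - ((holT (emlIterU j (bgUnits F K U₀)) (emb z) (stairWord i.2.1 (off i.1)) : (Matrix (Fin 2) (Fin 2) ℂ)ˣ) : Matrix (Fin 2) (Fin 2) ℂ) *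
          ns j (transl (emb z) (disp (stairWord i.2.1 (off i.1)))) * (((holT (emlIterU j (bgUnits F K U₀)) (emb z) (stairWord i.2.1 (off i.1)))⁻¹ : (Matrix (Fin 2) (Fin 2) ℂ)ˣ) : Matrix (Fin 2) (Fin 2) ℂ))
    {R : ℝ} (hR0 : 0 < R) (hR : R * sY ≤ e * eta F n K) (x : Site (F.P K) (K - n)) {M : ℝ}
    (hM : ∀ s : ℂ, ‖s‖ = R → ‖(((frameAccU (K - n) (bgUnits F K U₀) (fun b => expUnit ((s • Y) b) * bgUnits F K U₀ b) x)⁻¹ : (Matrix (Fin 2) (Fin 2) ℂ)ˣ) : Matrix (Fin 2) (Fin 2) ℂ) * (N (embIter (K - n) x) - fderiv ℂ (fun A : PBond (F.P K) 0 → Matrix (Fin 2) (Fin 2) ℂ => ((frameAccU (K - n) (bgUnits F K U₀) (fun b => expUnit (A b) * bgUnits F K U₀ b) x : (Matrix (Fin 2) (Fin 2) ℂ)ˣ) : Matrix (Fin 2) (Fin 2) ℂ)) (s • Y) (fun b : PBond (F.P K) 0 => fderiv ℂ (mlog : Matrix (Fin 2) (Fin 2) ℂ → Matrix (Fin 2)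 (Fin 2) ℂ) (exp ((s • Y) b)) (N b.src * exp ((s • Y) b) - exp ((s • Y) b) * (((bgUnits F K U₀ b : (Matrix (Fin 2) (Fin 2) ℂ)ˣ) : Matrix (Fin 2) (Fin 2) ℂ) * N b.tgt * (((bgUnits F K U₀ b)⁻¹ : (Matrix (Fin 2) (Fin 2) ℂ)ˣ) : Matrix (Fin 2) (Fin 2) ℂ)))) * (((frameAccU (K - n) (bgUnits F K U₀) (fun b => expUnit ((s • Y) b) * bgUnits F K U₀ b) x)⁻¹ : (Matrix (Fin 2) (Fin 2) ℂ)ˣ) : Matrix (Fin 2) (Fin 2) ℂ)) * ((frameAccU (K - n) (bgUnits F K U₀) (fun b => expUnit ((s • Y) b) * bgUnits F K U₀ b) x : (Matrix (Fin 2) (Fin 2) ℂ)ˣ) : Matrix (Fin 2) (Fin 2) ℂ)‖ ≤ M) :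
    ‖(ns (K - n) x * fderiv ℂ (fun A : PBond (F.P K) 0 → Matrix (Fin 2) (Fin 2) ℂ => ((frameAccU (K - n) (bgUnits F K U₀) (fun b => expUnit (A b) * bgUnits F K U₀ b) x : (Matrix (Fin 2) (Fin 2) ℂ)ˣ) : Matrix (Fin 2) (Fin 2) ℂ)) 0 Y - fderiv ℂ (fun A : PBond (F.P K) 0 → Matrix (Fin 2) (Fin 2) ℂ => ((frameAccU (K - n) (bgUnits F K U₀) (fun b => expUnit (A b) * bgUnits F K U₀ b) x : (Matrix (Fin 2) (Fin 2) ℂ)ˣ) : Matrix (Fin 2) (Fin 2) ℂ)) 0 Y * ns (K - n) x) + (N (embIter (K - n) x) - ns (K - n) x) * fderiv ℂ (fun A : PBond (F.P K) 0 → Matrix (Fin 2) (Fin 2) ℂ => ((frameAccU (K - n) (bgUnits F K U₀) (fun b => expUnit (A b) * bgUnits F K U₀ b) x : (Matrix (Fin 2) (Fin 2) ℂ)ˣ) : Matrix (Fin 2) (Fin 2) ℂ)) 0 Y - (fderiv ℂ (fderiv ℂ (fun A : PBond (F.P K) 0 → Matrix (Fin 2) (Fin 2) ℂ => ((frameAccU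 (K - n) (bgUnits F K U₀) (fun b => expUnit (A b) * bgUnits F K U₀ b) x : (Matrix (Fin 2) (Fin 2) ℂ)ˣ) : Matrix (Fin 2) (Fin 2) ℂ))) 0 Y (fun b : PBond (F.P K) 0 => N b.src - ((bgUnits F K U₀ b : (Matrix (Fin 2) (Fin 2) ℂ)ˣ) : Matrix (Fin 2) (Fin 2) ℂ) * N b.tgt * (((bgUnits F K U₀ b)⁻¹ : (Matrix (Fin 2) (Fin 2) ℂ)ˣ) : Matrix (Fin 2) (Fin 2) ℂ)) + fderiv ℂ (fun A : PBond (F.P K) 0 → Matrix (Fin 2) (Fin 2) ℂ => ((frameAccU (K - n) (bgUnits F K U₀) (fun b => expUnit (A b) * bgUnits F K U₀ b) x : (Matrix (Fin 2) (Fin 2) ℂ)ˣ) : Matrix (Fin 2) (Fin 2) ℂ)) 0 (fun b : PBond (F.P K) 0 => (2 : ℂ)⁻¹ • ((N b.src + ((bgUnits F K U₀ b : (Matrix (Fin 2) (Fin 2) ℂ)ˣ) : Matrix (Fin 2) (Fin 2) ℂ) * N b.tgt * (((bgUnits F K U₀ b)⁻¹ : (Matrix (Fin 2) (Fin 2) ℂ)ˣ)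 : Matrix (Fin 2) (Fin 2) ℂ)) * Y b - Y b * (N b.src + ((bgUnits F K U₀ b : (Matrix (Fin 2) (Fin 2) ℂ)ˣ) : Matrix (Fin 2) (Fin 2) ℂ) * N b.tgt * (((bgUnits F K U₀ b)⁻¹ : (Matrix (Fin 2) (Fin 2) ℂ)ˣ) : Matrix (Fin 2) (Fin 2) ℂ)))))‖ ≤ M / R :=
  norm_le_div_of_hasDerivAt_of_sphere hR0 (diffContOnCl_kappaAt_smul F h hε₀ he hWε hWe U₀ hreg hsY hY N hR x)
    (hasDerivAt_kappaAt_smul_site F h hε₀ hWε U₀ hreg Y N ns h0 hsucc x) hM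

include h in
/-- ★★★ **THE CAUCHY DOOR, SUMMED OVER THE TOP-LEVEL SITES**: with a site majorant `M x` on the circle `‖s‖ = R` (`0 < R`, `R·sY ≤ e·η`), **`Σ_x ‖κY(x)‖ ≤ R⁻¹·Σ_x M x`** — the shape in which
route R2's s-free majorant (F-B) is consumed. [cite: Balaban1985BackgroundPropagators, (3.114)–(3.115) p.418; Balaban1985Averaging, (97) p.32, Prop. 4 p.38] -/
theorem sum_norm_kappaY_le_of_sphere {ε₀ e : ℝ} (hε₀ : 0 < ε₀) (he : 0 ≤ e) (hWε : 10 ^ 12 * (F.L : ℝ) ^ 3 * ε₀ ≤ 1) (hWe : 10 ^ 9 * (F.L : ℝ) ^ 2 * e ≤ 1)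
    (U₀ : GaugeField (F.P K) 0 (Matrix.specialUnitaryGroup (Fin 2) ℂ)) (hreg : RegPr F n K ε₀ U₀) (Y : PBond (F.P K) 0 → Matrix (Fin 2) (Fin 2) ℂ) {sY : ℝ} (hsY : 0 ≤ sY) (hY : ∀ b, ‖Y b‖ ≤ sY)
    (N : Site (F.P K) 0 → Matrix (Fin 2) (Fin 2) ℂ) (ns : (j : ℕ) → Site (F.P K) j → Matrix (Fin 2) (Fin 2) ℂ) (h0 : ns 0 = N)
    (hsucc : ∀ (j : ℕ) (z : Site (F.P K) (j + 1)), ns (j + 1) z = ns j (emb z) - meanCLM (Idx (F.P K)) (Matrix (Fin 2) (Fin 2) ℂ) fun i : Idx (F.P K) =>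
        ns j (emb z) - ((holT (emlIterU j (bgUnits F K U₀)) (emb z) (stairWord i.2.1 (off i.1)) : (Matrix (Fin 2) (Fin 2) ℂ)ˣ) : Matrix (Fin 2) (Fin 2) ℂ) *
          ns j (transl (emb z) (disp (stairWord i.2.1 (off i.1)))) * (((holT (emlIterU j (bgUnits F K U₀)) (emb z) (stairWord i.2.1 (off i.1)))⁻¹ : (Matrix (Fin 2) (Fin 2) ℂ)ˣ) : Matrix (Fin 2) (Fin 2) ℂ))
    {R : ℝ} (hR0 : 0 < R) (hR : R * sY ≤ e * eta F n K) {M : Site (F.P K) (K - n) → ℝ}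
    (hM : ∀ (x : Site (F.P K) (K - n)) (s : ℂ), ‖s‖ = R → ‖(((frameAccU (K - n) (bgUnits F K U₀) (fun b => expUnit ((s • Y) b) * bgUnits F K U₀ b) x)⁻¹ : (Matrix (Fin 2) (Fin 2) ℂ)ˣ) : Matrix (Fin 2) (Fin 2) ℂ) * (N (embIter (K - n) x) - fderiv ℂ (fun A : PBond (F.P K) 0 → Matrix (Fin 2) (Fin 2) ℂ => ((frameAccU (K - n) (bgUnits F K U₀) (fun b => expUnit (A b) * bgUnits F K U₀ b) x : (Matrix (Fin 2) (Fin 2) ℂ)ˣ) : Matrix (Fin 2) (Fin 2) ℂ)) (s • Y) (fun b : PBond (F.P K) 0 => fderiv ℂ (mlog : Matrix (Fin 2) (Fin 2) ℂ → Matrix (Fin 2) (Fin 2) ℂ) (exp ((s • Y) b)) (N b.src * exp ((s • Y) b) - exp ((s • Y) b) * (((bgUnits F K U₀ b : (Matrix (Fin 2) (Fin 2) ℂ)ˣ) : Matrix (Fin 2) (Fin 2) ℂ) * N b.tgt * (((bgUnits F K U₀ b)⁻¹ : (Matrix (Fin 2) (Fin 2) ℂ)ˣ) : Matrix (Fin 2)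 (Fin 2) ℂ)))) * (((frameAccU (K - n) (bgUnits F K U₀) (fun b => expUnit ((s • Y) b) * bgUnits F K U₀ b) x)⁻¹ : (Matrix (Fin 2) (Fin 2) ℂ)ˣ) : Matrix (Fin 2) (Fin 2) ℂ)) * ((frameAccU (K - n) (bgUnits F K U₀) (fun b => expUnit ((s • Y) b) * bgUnits F K U₀ b) x : (Matrix (Fin 2) (Fin 2) ℂ)ˣ) : Matrix (Fin 2) (Fin 2) ℂ)‖ ≤ M x) :
    ∑ x : Site (F.P K) (K - n), ‖(ns (K - n) x * fderiv ℂ (fun A : PBond (F.P K) 0 → Matrix (Fin 2) (Fin 2) ℂ => ((frameAccU (K - n) (bgUnits F K U₀) (fun b => expUnit (A b) * bgUnits F K U₀ b) x : (Matrix (Fin 2) (Fin 2) ℂ)ˣ) : Matrix (Fin 2) (Fin 2) ℂ)) 0 Y - fderiv ℂ (fun A : PBond (F.P K) 0 → Matrix (Fin 2) (Fin 2) ℂ => ((frameAccU (K - n) (bgUnits F K U₀) (fun b => expUnit (A b) * bgUnits F K U₀ b) x : (Matrix (Fin 2) (Fin 2) ℂ)ˣ) : Matrix (Fin 2) (Fin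 2) ℂ)) 0 Y * ns (K - n) x) + (N (embIter (K - n) x) - ns (K - n) x) * fderiv ℂ (fun A : PBond (F.P K) 0 → Matrix (Fin 2) (Fin 2) ℂ => ((frameAccU (K - n) (bgUnits F K U₀) (fun b => expUnit (A b) * bgUnits F K U₀ b) x : (Matrix (Fin 2) (Fin 2) ℂ)ˣ) : Matrix (Fin 2) (Fin 2) ℂ)) 0 Y - (fderiv ℂ (fderiv ℂ (fun A : PBond (F.P K) 0 → Matrix (Fin 2) (Fin 2) ℂ => ((frameAccU (K - n) (bgUnits F K U₀) (fun b => expUnit (A b) * bgUnits F K U₀ b) x : (Matrix (Fin 2) (Fin 2) ℂ)ˣ) : Matrix (Fin 2) (Fin 2) ℂ))) 0 Y (fun b : PBond (F.P K) 0 => N b.src - ((bgUnits F K U₀ b : (Matrix (Fin 2) (Fin 2) ℂ)ˣ) : Matrix (Fin 2) (Fin 2) ℂ) * N b.tgt * (((bgUnits F K U₀ b)⁻¹ : (Matrix (Fin 2) (Fin 2) ℂ)ˣ) : Matrix (Fin 2) (Fin 2) ℂ)) + fderiv ℂ (fun A : PBond (F.P K) 0 → Matrix (Fin 2) (Fin 2)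 ℂ => ((frameAccU (K - n) (bgUnits F K U₀) (fun b => expUnit (A b) * bgUnits F K U₀ b) x : (Matrix (Fin 2) (Fin 2) ℂ)ˣ) : Matrix (Fin 2) (Fin 2) ℂ)) 0 (fun b : PBond (F.P K) 0 => (2 : ℂ)⁻¹ • ((N b.src + ((bgUnits F K U₀ b : (Matrix (Fin 2) (Fin 2) ℂ)ˣ) : Matrix (Fin 2) (Fin 2) ℂ) * N b.tgt * (((bgUnits F K U₀ b)⁻¹ : (Matrix (Fin 2) (Fin 2) ℂ)ˣ) : Matrix (Fin 2) (Fin 2) ℂ)) * Y b - Y b * (N b.src + ((bgUnits F K U₀ b : (Matrix (Fin 2) (Fin 2) ℂ)ˣ) : Matrix (Fin 2) (Fin 2) ℂ) * N b.tgt * (((bgUnits F K U₀ b)⁻¹ : (Matrix (Fin 2) (Fin 2) ℂ)ˣ) : Matrix (Fin 2) (Fin 2) ℂ)))))‖ ≤ R⁻¹ * ∑ x : Site (F.P K) (K - n), M x := by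
  rw [Finset.mul_sum]
  refine Finset.sum_le_sum fun x _ => ?_
  rw [inv_mul_eq_div]
  exact norm_kappaY_le_of_sphere F h hε₀ he hWε hWe U₀ hreg Y hsY hY N ns h0 hsucc hR0 hR x (hM x)

include h in
/-- ★★★ **«FR₂-lite»'s SHAPE FROM AN s-FREE MAJORANT** (the socket for F-B): at the radius `R := e·η∕sY` (`0 < e`, `0 < sY`), a circle majorant `M x` with **`Σ_x M x ≤ C_B·(ℓ⁻¹)³·a`**
(`ℓ⁻¹ = (L^{K−n})⁻¹ = η`, `a` = the spike's size; any reals `C_B`, `a`) gives **`Σ_x ‖κY(x)‖ ≤ (C_B∕e)·(ℓ⁻¹)²·sY·a`** — one power of `ℓ⁻¹` is spent on `R⁻¹ = sY·ℓ∕e`, exactly the `ℓ⁻²` of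
✓p777532 `hqG_of_FR2_family`'s `hFR2`. [cite: Balaban1985BackgroundPropagators, (3.114)–(3.115) p.418; Balaban1985Averaging, (97) p.32, Prop. 5 (157) p.42] -/
theorem sum_norm_kappaY_le_of_majorant {ε₀ e : ℝ} (hε₀ : 0 < ε₀) (he : 0 < e) (hWε : 10 ^ 12 * (F.L : ℝ) ^ 3 * ε₀ ≤ 1) (hWe : 10 ^ 9 * (F.L : ℝ) ^ 2 * e ≤ 1)
    (U₀ : GaugeField (F.P K) 0 (Matrix.specialUnitaryGroup (Fin 2) ℂ)) (hreg : RegPr F n K ε₀ U₀) (Y : PBond (F.P K) 0 → Matrix (Fin 2) (Fin 2) ℂ) {sY : ℝ} (hsY : 0 < sY) (hY : ∀ b, ‖Y b‖ ≤ sY)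
    (N : Site (F.P K) 0 → Matrix (Fin 2) (Fin 2) ℂ) (ns : (j : ℕ) → Site (F.P K) j → Matrix (Fin 2) (Fin 2) ℂ) (h0 : ns 0 = N)
    (hsucc : ∀ (j : ℕ) (z : Site (F.P K) (j + 1)), ns (j + 1) z = ns j (emb z) - meanCLM (Idx (F.P K)) (Matrix (Fin 2) (Fin 2) ℂ) fun i : Idx (F.P K) =>
        ns j (emb z) - ((holT (emlIterU j (bgUnits F K U₀)) (emb z) (stairWord i.2.1 (off i.1)) : (Matrix (Fin 2) (Fin 2) ℂ)ˣ) : Matrix (Fin 2) (Fin 2) ℂ) *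
          ns j (transl (emb z) (disp (stairWord i.2.1 (off i.1)))) * (((holT (emlIterU j (bgUnits F K U₀)) (emb z) (stairWord i.2.1 (off i.1)))⁻¹ : (Matrix (Fin 2) (Fin 2) ℂ)ˣ) : Matrix (Fin 2) (Fin 2) ℂ))
    {M : Site (F.P K) (K - n) → ℝ} {CB a : ℝ}
    (hM : ∀ (x : Site (F.P K) (K - n)) (s : ℂ), ‖s‖ = e * eta F n K / sY → ‖(((frameAccU (K - n) (bgUnits F K U₀) (fun b => expUnit ((s • Y) b) * bgUnits F K U₀ b) x)⁻¹ : (Matrix (Fin 2) (Fin 2) ℂ)ˣ) : Matrix (Fin 2) (Fin 2) ℂ) * (N (embIter (K - n) x) - fderiv ℂ (fun A : PBond (F.P K) 0 → Matrix (Fin 2) (Fin 2) ℂ => ((frameAccU (K - n) (bgUnits F K U₀) (fun b => expUnit (A b) * bgUnits F K U₀ b) x : (Matrix (Fin 2) (Fin 2) ℂ)ˣ) : Matrix (Fin 2) (Fin 2) ℂ)) (s • Y) (fun b : PBond (F.P K) 0 => fderiv ℂ (mlog : Matrix (Fin 2) (Fin 2) ℂ → Matrix (Fin 2) (Fin 2)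 ℂ) (exp ((s • Y) b)) (N b.src * exp ((s • Y) b) - exp ((s • Y) b) * (((bgUnits F K U₀ b : (Matrix (Fin 2) (Fin 2) ℂ)ˣ) : Matrix (Fin 2) (Fin 2) ℂ) * N b.tgt * (((bgUnits F K U₀ b)⁻¹ : (Matrix (Fin 2) (Fin 2) ℂ)ˣ) : Matrix (Fin 2) (Fin 2) ℂ)))) * (((frameAccU (K - n) (bgUnits F K U₀) (fun b => expUnit ((s • Y) b) * bgUnits F K U₀ b) x)⁻¹ : (Matrix (Fin 2) (Fin 2) ℂ)ˣ) : Matrix (Fin 2) (Fin 2) ℂ)) * ((frameAccU (K - n) (bgUnits F K U₀) (fun b => expUnit ((s • Y) b) * bgUnits F K U₀ b) x : (Matrix (Fin 2) (Fin 2) ℂ)ˣ) : Matrix (Fin 2) (Fin 2) ℂ)‖ ≤ M x)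
    (hsum : ∑ x : Site (F.P K) (K - n), M x ≤ CB * (((F.L : ℝ) ^ (K - n))⁻¹) ^ 3 * a) :
    ∑ x : Site (F.P K) (K - n), ‖(ns (K - n) x * fderiv ℂ (fun A : PBond (F.P K) 0 → Matrix (Fin 2) (Fin 2) ℂ => ((frameAccU (K - n) (bgUnits F K U₀) (fun b => expUnit (A b) * bgUnits F K U₀ b) x : (Matrix (Fin 2) (Fin 2) ℂ)ˣ) : Matrix (Fin 2) (Fin 2) ℂ)) 0 Y - fderiv ℂ (fun A : PBond (F.P K) 0 → Matrix (Fin 2) (Fin 2) ℂ => ((frameAccU (K - n) (bgUnits F K U₀) (fun b => expUnit (A b) * bgUnits F K U₀ b) x : (Matrix (Fin 2) (Fin 2) ℂ)ˣ) : Matrix (Fin 2) (Fin 2) ℂ)) 0 Y * ns (K - n) x) + (N (embIter (K - n) x) - ns (K - n) x) * fderiv ℂ (fun A : PBond (F.P K) 0 → Matrix (Fin 2) (Fin 2) ℂ => ((frameAccU (K - n) (bgUnits F K U₀) (fun b => expUnit (A b) * bgUnits F K U₀ b) x : (Matrix (Fin 2) (Fin 2) ℂ)ˣ) : Matrix (Fin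 2) (Fin 2) ℂ)) 0 Y - (fderiv ℂ (fderiv ℂ (fun A : PBond (F.P K) 0 → Matrix (Fin 2) (Fin 2) ℂ => ((frameAccU (K - n) (bgUnits F K U₀) (fun b => expUnit (A b) * bgUnits F K U₀ b) x : (Matrix (Fin 2) (Fin 2) ℂ)ˣ) : Matrix (Fin 2) (Fin 2) ℂ))) 0 Y (fun b : PBond (F.P K) 0 => N b.src - ((bgUnits F K U₀ b : (Matrix (Fin 2) (Fin 2) ℂ)ˣ) : Matrix (Fin 2) (Fin 2) ℂ) * N b.tgt * (((bgUnits F K U₀ b)⁻¹ : (Matrix (Fin 2) (Fin 2) ℂ)ˣ) : Matrix (Fin 2) (Fin 2) ℂ)) + fderiv ℂ (fun A : PBond (F.P K) 0 → Matrix (Fin 2) (Fin 2) ℂ => ((frameAccU (K - n) (bgUnits F K U₀) (fun b => expUnit (A b) * bgUnits F K U₀ b) x : (Matrix (Fin 2) (Fin 2) ℂ)ˣ) : Matrix (Fin 2) (Fin 2) ℂ)) 0 (fun b : PBond (F.P K) 0 => (2 : ℂ)⁻¹ • ((N b.src + ((bgUnits F K U₀ b : (Matrix (Fin 2) (Fin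 2) ℂ)ˣ) : Matrix (Fin 2) (Fin 2) ℂ) * N b.tgt * (((bgUnits F K U₀ b)⁻¹ : (Matrix (Fin 2) (Fin 2) ℂ)ˣ) : Matrix (Fin 2) (Fin 2) ℂ)) * Y b - Y b * (N b.src + ((bgUnits F K U₀ b : (Matrix (Fin 2) (Fin 2) ℂ)ˣ) : Matrix (Fin 2) (Fin 2) ℂ) * N b.tgt * (((bgUnits F K U₀ b)⁻¹ : (Matrix (Fin 2) (Fin 2) ℂ)ˣ) : Matrix (Fin 2) (Fin 2) ℂ)))))‖ ≤ CB / e * (((F.L : ℝ) ^ (K - n))⁻¹) ^ 2 * sY * a := by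
  have hη : 0 < eta F n K := eta_pos F n K
  have hηdef : eta F n K = ((F.L : ℝ) ^ (K - n))⁻¹ := by
    show ((F.L : ℝ)⁻¹) ^ (K - n) = _
    rw [inv_pow]
  have hR0 : 0 < e * eta F n K / sY := div_pos (mul_pos he hη) hsY
  have hR : e * eta F n K / sY * sY ≤ e * eta F n K := (div_mul_cancel₀ _ hsY.ne').le
  have h1 := sum_norm_kappaY_le_of_sphere F h hε₀ he.le hWε hWe U₀ hreg Y hsY.le hY N ns h0 hsucc hR0 hR hM
  refine h1.trans ?_
  calc (e * eta F n K / sY)⁻¹ * ∑ x : Site (F.P K) (K - n), M x ≤ (e * eta F n K / sY)⁻¹ * (CB * (((F.L : ℝ) ^ (K - n))⁻¹) ^ 3 * a) :=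
        mul_le_mul_of_nonneg_left hsum (inv_nonneg.2 hR0.le)
    _ = CB / e * (((F.L : ℝ) ^ (K - n))⁻¹) ^ 2 * sY * a := by
        rw [hηdef]
        have hℓ : ((F.L : ℝ) ^ (K - n))⁻¹ ≠ 0 := by rw [← hηdef]; exact hη.ne'
        field_simp

end Member

end Summit.QuantumFields.YangMills.Theorems.Prop7KappaAtDiscCauchy

end
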